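import Mathlib
import Summits.MatrixMultiplication.MatrixMultiplication.Theorems.HiddenToeplitzCornersHiddenCornerLemmaRToeplitzThreeSlot

/-!
# Mixed law, honest-Toeplitz sub-case (hidden-corner lemma, crux stmt-MatrixMultiplication-10752)

Support file for crux item `stmt-MatrixMultiplication-10752`
(`Summit.MatrixMultiplication.MatrixMultiplication.Theses.HiddenToeplitzCorners.HiddenCornerLemmaR`),
line `frobenius-dual-short-syzygies`, stub `stub_mixedLaw`.

In the mixed compression class (`∇(T a b) = G₀ (H₁ a b)ᵀ + (G₁ a b) H₀ᵀ`, constant `G₀ : N × p`,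
`H₀ : N × q`) suppose the constant generators are supported on row `0`.  Then every displacement
`∇(T a b)` is supported on row `0 ∪` column `0`, so every coefficient matrix is an honest Toeplitz
matrix (`hclR`-style shift bookkeeping below), and the Toeplitz three-slot lemma
`hclR_toeplitz_three_slot` kills every target column as soon as `r ≥ 3`.  Results:

* `hclR_mixed_row0_bound`: `rank F = r` and the corner identity alone give `r ≤ 2` (all `p, q`;
  no nonsingularity, no hypothesis on `E`); sharp by `ToeplitzCornerTwo` (`r = 2`, `N = 4`).
* `hclR_mixed_row0_stub`: the registered stub `stub_mixedLaw` with the two support hypotheses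
  added, conclusion `r ≤ 2 * p + q`.

General constant generators are NOT covered here: for `(p,q) = (1,1)` with arbitrary `G₀`, `H₀`
see `HiddenCornerLemmaRMixedOneOne` (`hclR_mixed_one_one_stub`, `r ≤ 2`, via the normal form
`G₀ = e_γ`, `H₀ = e_ω` of `HiddenCornerLemmaRMixedNF1/NF2`); the classes with `p ≥ 2` contain the
G-constant dual law (`stub_gconstDualLaw`) below the cut and remain open.
-/

set_option linter.dupNamespace false

namespace Summit.MatrixMultiplication.MatrixMultiplication.Theorems

open Matrix BigOperators Finset

/-! ## From the stub's displacement form to honest Toeplitz matrices -/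

/-- Entries of `Z * M * Zᵀ` away from row `0` and column `0`: `(Z M Zᵀ) i j = M (i-1) (j-1)`. -/
private theorem toep3_shift_conj_apply {N : ℕ} (M : Matrix (Fin N) (Fin N) ℂ) (i j : Fin N)
    (hi : 0 < (i : ℕ)) (hj : 0 < (j : ℕ)) :
    ((Matrix.of fun i j : Fin N => if (i : ℕ) = (j : ℕ) + 1 then (1 : ℂ) else 0) * M *
      (Matrix.of fun i j : Fin N => if (i : ℕ) = (j : ℕ) + 1 then (1 : ℂ) else 0)ᵀ) i j =
      M ⟨(i : ℕ) - 1, by omega⟩ ⟨(j : ℕ) - 1, by omega⟩ := by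
  rw [Matrix.mul_apply]
  simp only [Matrix.transpose_apply, Matrix.mul_apply, Matrix.of_apply]
  rw [Finset.sum_eq_single ⟨(j : ℕ) - 1, by omega⟩]
  · rw [if_pos (by simp; omega), mul_one]
    rw [Finset.sum_eq_single ⟨(i : ℕ) - 1, by omega⟩]
    · rw [if_pos (by simp; omega), one_mul]
    · intro a _ ha
      rw [if_neg, zero_mul]
      intro h'
      apply ha
      ext
      simp only at h' ⊢
      omega
    · simp
  · intro b _ hb
    rw [if_neg, mul_zero]
    intro h'
    apply hb
    ext
    simp only at h' ⊢
    omega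
  · simp

/-- A matrix whose Stein displacement `M - Z M Zᵀ` vanishes away from row `0` and column `0` is an
honest Toeplitz matrix (`M i j` depends only on `i - j`). -/
private theorem toep3_toeplitz_of_disp {N : ℕ} (M D : Matrix (Fin N) (Fin N) ℂ)
    (h : M - (Matrix.of fun i j : Fin N => if (i : ℕ) = (j : ℕ) + 1 then (1 : ℂ) else 0) * M *
      (Matrix.of fun i j : Fin N => if (i : ℕ) = (j : ℕ) + 1 then (1 : ℂ) else 0)ᵀ = D)
    (hD : ∀ i j : Fin N, (i : ℕ) ≠ 0 → (j : ℕ) ≠ 0 → D i j = 0) :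
    ∀ i j i' j' : Fin N, (i : ℕ) + j' = i' + j → M i j = M i' j' := by
  have hstep : ∀ i j : Fin N, ∀ (hi : 0 < (i : ℕ)) (hj : 0 < (j : ℕ)),
      M i j = M ⟨(i : ℕ) - 1, by omega⟩ ⟨(j : ℕ) - 1, by omega⟩ := by
    intro i j hi hj
    have e := congr_fun (congr_fun h i) j
    rw [Matrix.sub_apply, toep3_shift_conj_apply M i j hi hj, hD i j (by omega) (by omega)] at e
    exact sub_eq_zero.mp e
  have hcanon : ∀ d : ℕ, ∀ i j i₀ j₀ : Fin N, (i : ℕ) = i₀ + d → (j : ℕ) = j₀ + d →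
      M i j = M i₀ j₀ := by
    intro d
    induction d with
    | zero =>
      intro i j i₀ j₀ hi hj
      have e1 : i = i₀ := Fin.ext (by omega)
      have e2 : j = j₀ := Fin.ext (by omega)
      rw [e1, e2]
    | succ d ih =>
      intro i j i₀ j₀ hi hj
      rw [hstep i j (by omega) (by omega)]
      exact ih _ _ i₀ j₀ (by simp; omega) (by simp; omega)
  intro i j i' j' hsum
  have hi₀ : (i : ℕ) - min (i : ℕ) j < N := by omega
  have hj₀ : (j : ℕ) - min (i : ℕ) j < N := by omega
  rw [hcanon (min (i : ℕ) j) i j ⟨_, hi₀⟩ ⟨_, hj₀⟩ (by simp) (by simp),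
    hcanon (min (i' : ℕ) j') i' j' ⟨_, hi₀⟩ ⟨_, hj₀⟩ (by simp; omega) (by simp; omega)]

/-- Corner per coefficient: testing `T(X) E = F X` at `X = single a b 1` gives
`T a b *ᵥ (col c of E) = [b = c] • (col a of F)`. -/
private theorem toep3_corner_col {r N : ℕ} (T : Fin r → Fin r → Matrix (Fin N) (Fin N) ℂ)
    (E F : Matrix (Fin N) (Fin r) ℂ)
    (hcorner : ∀ X : Matrix (Fin r) (Fin r) ℂ, (∑ a : Fin r, ∑ b : Fin r, X a b • T a b) * E = F * X)
    (a b c : Fin r) :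
    T a b *ᵥ (fun i => E i c) = if b = c then (fun i => F i a) else 0 := by
  -- adapted from `hclR_gconst_d_one` (column extraction of the corner identity)
  have h1 := hcorner (Matrix.single a b 1)
  have hsum : (∑ a' : Fin r, ∑ b' : Fin r, (Matrix.single a b (1 : ℂ)) a' b' • T a' b') = T a b := by
    rw [Finset.sum_eq_single a]
    · rw [Finset.sum_eq_single b]
      · simp
      · intro b' _ hb'; simp [hb'.symm]
      · simp
    · intro a' _ ha'
      apply Finset.sum_eq_zero; intro b' _
      simp [ha'.symm]
    · simp
  rw [hsum] at h1
  ext i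
  have h2 := congr_fun (congr_fun h1 i) c
  rw [Matrix.mul_apply] at h2
  simp only [Matrix.mulVec, dotProduct]
  rw [h2, Matrix.mul_apply]
  by_cases hbc : b = c
  · subst hbc
    rw [if_pos rfl, Finset.sum_eq_single a]
    · simp
    · intro j _ hj; simp [hj.symm]
    · simp
  · rw [if_neg hbc]
    simp only [Pi.zero_apply]
    apply Finset.sum_eq_zero; intro j _
    simp only [Matrix.single_apply, mul_ite, mul_one, mul_zero, ite_eq_right_iff, and_imp]
    intro _ hbc'; exact absurd hbc' hbc

/-- **Mixed law, honest-Toeplitz sub-case.**  In the mixed compression class of `stub_mixedLaw`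
(`∇(T a b) = G₀ (H₁ a b)ᵀ + (G₁ a b) H₀ᵀ` with constant `G₀ : N × p`, `H₀ : N × q`), suppose the
constant generators `G₀` and `H₀` are supported on row `0` (equivalently: every coefficient matrix
`T a b` is an honest Toeplitz matrix).  If the pencil hides a linearly explained corner
`T(X) E = F X` with `rank F = r`, then `r ≤ 2` — for every `p, q`, with no nonsingularity and no
hypothesis on `E`.  (Three slots `b = 0, 1, 2` and `hclR_toeplitz_three_slot` force every target
column `F a` to vanish.)  The bound is sharp: `ToeplitzCornerTwo` is an honest Toeplitz pencil
hiding a `2 × 2` corner. -/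
theorem hclR_mixed_row0_bound (r N p q : ℕ) (T : Fin r → Fin r → Matrix (Fin N) (Fin N) ℂ)
    (E F : Matrix (Fin N) (Fin r) ℂ) (G₀ : Matrix (Fin N) (Fin p) ℂ) (H₀ : Matrix (Fin N) (Fin q) ℂ)
    (H₁ : Fin r → Fin r → Matrix (Fin N) (Fin p) ℂ) (G₁ : Fin r → Fin r → Matrix (Fin N) (Fin q) ℂ)
    (hG₀ : ∀ (i : Fin N) (k : Fin p), (i : ℕ) ≠ 0 → G₀ i k = 0)
    (hH₀ : ∀ (i : Fin N) (k : Fin q), (i : ℕ) ≠ 0 → H₀ i k = 0)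
    (hF : F.rank = r)
    (hcorner : ∀ X : Matrix (Fin r) (Fin r) ℂ, (∑ a : Fin r, ∑ b : Fin r, X a b • T a b) * E = F * X)
    (hdisp : ∀ a b, T a b - (Matrix.of fun i j : Fin N => if (i : ℕ) = (j : ℕ) + 1 then (1 : ℂ) else 0) *
        T a b * (Matrix.of fun i j : Fin N => if (i : ℕ) = (j : ℕ) + 1 then (1 : ℂ) else 0)ᵀ
        = G₀ * (H₁ a b)ᵀ + G₁ a b * H₀ᵀ) :
    r ≤ 2 := by
  by_contra hr
  push Not at hr
  have htoep : ∀ a b, ∀ i j i' j' : Fin N, (i : ℕ) + j' = i' + j → T a b i j = T a b i' j' := by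
    intro a b
    refine toep3_toeplitz_of_disp (T a b) _ (hdisp a b) ?_
    intro i j hi hj
    rw [Matrix.add_apply, Matrix.mul_apply, Matrix.mul_apply]
    rw [Finset.sum_eq_zero, Finset.sum_eq_zero, add_zero]
    · intro k _; rw [Matrix.transpose_apply, hH₀ j k hj, mul_zero]
    · intro k _; rw [hG₀ i k hi, zero_mul]
  -- three slots `0, 1, 2 : Fin r`
  let β : Fin 3 → Fin r := fun s => ⟨(s : ℕ), by omega⟩
  have hβ : ∀ s t : Fin 3, β s = β t → s = t := by
    intro s t h
    have := congrArg Fin.val h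
    exact Fin.ext this
  have hFcol : ∀ a : Fin r, (fun i => F i a) = 0 := by
    intro a
    refine hclR_toeplitz_three_slot (fun s => T a (β s)) (fun s => htoep a (β s))
      (fun s i => E i (β s)) (fun i => F i a) ?_
    intro s t
    show T a (β s) *ᵥ (fun i => E i (β t)) = if s = t then (fun i => F i a) else 0
    rw [toep3_corner_col T E F hcorner a (β s) (β t)]
    by_cases hst : s = t
    · subst hst; rw [if_pos rfl, if_pos rfl]
    · rw [if_neg (fun h => hst (hβ s t h)), if_neg hst]
  have hF0 : F = 0 := by
    ext i a
    exact congr_fun (hFcol a) i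
  rw [hF0, Matrix.rank_zero] at hF
  omega

/-- **`stub_mixedLaw` in the honest-Toeplitz sub-case** (the stub's exact binders and hypotheses,
plus the two support hypotheses on `G₀`, `H₀`): `r ≤ 2 ≤ 2p + q`. -/
theorem hclR_mixed_row0_stub :
    ∀ (r N p q : ℕ) (T : Fin r → Fin r → Matrix (Fin N) (Fin N) ℂ) (E F : Matrix (Fin N) (Fin r) ℂ)
      (G₀ : Matrix (Fin N) (Fin p) ℂ) (H₀ : Matrix (Fin N) (Fin q) ℂ)
      (H₁ : Fin r → Fin r → Matrix (Fin N) (Fin p) ℂ) (G₁ : Fin r → Fin r → Matrix (Fin N) (Fin q) ℂ),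
      (∀ (i : Fin N) (k : Fin p), (i : ℕ) ≠ 0 → G₀ i k = 0) →
      (∀ (i : Fin N) (k : Fin q), (i : ℕ) ≠ 0 → H₀ i k = 0) →
      0 < p → 0 < q → E.rank = r → F.rank = r →
      (∀ X : Matrix (Fin r) (Fin r) ℂ, (∑ a : Fin r, ∑ b : Fin r, X a b • T a b) * E = F * X) →
      (∀ a b, T a b - (Matrix.of fun i j : Fin N => if (i : ℕ) = (j : ℕ) + 1 then (1 : ℂ) else 0) * T a b *
          (Matrix.of fun i j : Fin N => if (i : ℕ) = (j : ℕ) + 1 then (1 : ℂ) else 0)ᵀ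
          = G₀ * (H₁ a b)ᵀ + G₁ a b * H₀ᵀ) →
      (∃ X₀ : Matrix (Fin r) (Fin r) ℂ, (∑ a : Fin r, ∑ b : Fin r, X₀ a b • T a b).det ≠ 0) →
      r ≤ 2 * p + q := by
  intro r N p q T E F G₀ H₀ H₁ G₁ hG₀ hH₀ hp _hq _hE hF hcorner hdisp _hns
  have := hclR_mixed_row0_bound r N p q T E F G₀ H₀ H₁ G₁ hG₀ hH₀ hF hcorner hdisp
  omega

end Summit.MatrixMultiplication.MatrixMultiplication.Theorems
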